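import Summits.NavierStokesRegularity.FluidComputer.VorticityTypeIFace
import HarnessLib

/-!
# Fluid computer — L65-S: BEALE–KATO–MAJDA WITH AN EXPLICIT LOGARITHMIC FLOOR —
# `4 ∫_{t₀}^t ‖ω‖_∞ ≥ log( c ν³ / (Z(t₀)² (T − t)) )`, `Z(t₀) = ∫|ω(t₀)|²`, along every Navier–Stokes blow-up

HONEST FRAMING (cell `pub-fluidc`, verbatim): *low prior, high value-of-information experiment on Tao's
machine paradigm; NOT a claim that NS blows up.* Theorem side of the cell (the level dictionary); nothing here is
evidence of blow-up — necessities for EVERY maximal smooth finite-energy solution on `ℝ³`.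

L31 (BKM on the class) says `∫_{t₀}^T ‖ω(t)‖_∞ dt = ∞` on every terminal window; L65 (`VorticityTypeIFace`) that
`(T − t)‖ω(t)‖_∞ ≥ 1/4 − o(1)` along a sequence. This file gives the TIME-INTEGRATED form with the SAME explicit constant:
Robinson–Rodrigo–Sadowski's a priori estimate (12.12), `‖ω(t)‖₂² ≤ ‖ω(t₀)‖₂² exp(2∫_{t₀}^t ‖ω‖_∞)`, typed in the tree only
with the slab SUPREMUM of `‖ω‖_∞` (`integral_sq_norm_curl_le_mul_exp_of_norm_curl_le`), is upgraded here to a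
continuous time-dependent majorant by uniform partitions (uniform continuity; upper Riemann sums), and read against
Leray's rate (L19). Along every maximal smooth solution `(u, p)` of the unforced Navier–Stokes system on `ℝ³ × [0, T)`
(`ν > 0`) which is Leray–Hopf from `u 0`, with `Z(t) = ∫|curl u(t)|²`:

* `enstrophy_chain` — the slab estimate chained along a uniform partition of `[s, t] ⊂ (0, T)`:
  `Z(t) ≤ Z(s)·exp(2 ∑_{i<N} Ω_i (t − s)/N)` when `‖ω‖ ≤ Ω_i` on the `i`-th slab;
* `enstrophy_le_mul_exp_integral` (**RRS (12.12) WITH A TIME-DEPENDENT MAJORANT, on the class**): for every continuous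
  `m` on `[s, t]` with `‖ω(τ, x)‖ ≤ m(τ)` there, `Z(t) ≤ Z(s)·exp(2∫_s^t m)`;
* `bkm_log_floor` (**L65-S — BKM WITH THE LOG FLOOR `1/4`**): with the absolute constant `c` of Leray's clock
  (`leray_curl_clock`), for every `t₀ ∈ (0, T)`, every continuous majorant `m` of `‖ω(τ)‖_∞` on `[t₀, T)` and every
  `t ∈ [t₀, T)`: `c ν³ ≤ Z(t₀)² · exp(4∫_{t₀}^t m) · (T − t)`, i.e. (`bkm_log_floor_log`)
  **`log( cν³ / (Z(t₀)²(T − t)) ) ≤ 4 ∫_{t₀}^t m`** — the running BKM integral must grow at least like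
  `(1/4)·log(1/(T − t))`, with an additive constant fixed by the enstrophy at `t₀` and `ν`.

Reading for the machine paradigm: plot the running `∫_{t₀}^t max_x|ω|` against `log(1/(T − t))` for the extrapolated `T`:
approaching a genuine singularity the curve lies above a line of SLOPE `1/4` (offset `¼ log(cν³/Z(t₀)²)`, `c` inexplicit);
a BKM integral growing slower than a quarter-logarithm is not heading to a singularity at that `T`. L65 follows from
L65-S. HONEST PLACEMENT: a corollary of RRS 2016 (12.12) and Leray's rate (RRS Lemma 6.11), not located in print as a
stated floor; `1/4` not claimed optimal; `ν > 0` used. Necessity only. 0 sorry; no definitions; no named facts.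

## References

* J. C. Robinson, J. L. Rodrigo, W. Sadowski, *The Three-Dimensional Navier–Stokes Equations*, CUP 2016, Thm 12.3
  with (12.11)–(12.12); Lemma 6.11. [RobinsonRodrigoSadowski2016]
* J. T. Beale, T. Kato, A. Majda, Comm. Math. Phys. 94 (1984) 61–66, Thm. 1. [BealeKatoMajda1984]
* J. Leray, Acta Math. 63 (1934) 193–248, §20. [Leray1934]
-/

noncomputable section

open MeasureTheory Set Function Filter Topology Metric
open scoped ENNReal NNReal RealInnerProductSpace
open Literature.Analysis.FluidPDE Literature.Analysis.FunctionSpaces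
open Summit.NavierStokesRegularity.FluidComputer.VorticityTypeIFace (enstrophy_slab_step leray_curl_clock)

namespace Summit.NavierStokesRegularity.FluidComputer.VorticityLogFloor

/-! ## The slab estimate chained along a uniform partition -/

/-- **The chain.** For `0 < s < t < T`, `N ≥ 1`, the uniform partition `τ_i = s + i(t − s)/N`, and constants `Ω_i` with
`‖ω(τ, x)‖ ≤ Ω_i` on `[τ_i, τ_{i+1}] × ℝ³` (`i < N`): `∫|ω(t)|² ≤ (∫|ω(s)|²)·exp(2∑_{i<N} Ω_i (t − s)/N)`
(`enstrophy_slab_step` on each slab, induction on `i`). [cite: RobinsonRodrigoSadowski2016, Thm 12.3 (12.12)] -/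
theorem enstrophy_chain {ν T : ℝ} (hν : 0 < ν) (hT : 0 < T)
    {u : ℝ → EuclideanSpace ℝ (Fin 3) → EuclideanSpace ℝ (Fin 3)} {p : ℝ → EuclideanSpace ℝ (Fin 3) → ℝ}
    (hmax : IsMaximalSmoothSolution ν 0 u p T) (hLH : IsLerayHopfOn T ν 0 (u 0) u)
    {s t : ℝ} (hs : 0 < s) (hst : s < t) (htT : t < T) {N : ℕ} (hN : 0 < N) (Ω : ℕ → ℝ)
    (hΩ : ∀ i < N, ∀ τ ∈ Icc (s + (i : ℝ) * ((t - s) / N)) (s + ((i : ℝ) + 1) * ((t - s) / N)), ∀ x,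
      ‖curl (u τ) x‖ ≤ Ω i) :
    ∫ x, ‖curl (u t) x‖ ^ 2 ≤
      (∫ x, ‖curl (u s) x‖ ^ 2) * Real.exp (2 * ∑ i ∈ Finset.range N, Ω i * ((t - s) / N)) := by
  set Δ : ℝ := (t - s) / N with hΔ
  have hNr : (0 : ℝ) < N := by exact_mod_cast hN
  have hΔ0 : 0 < Δ := div_pos (sub_pos.2 hst) hNr
  set τ : ℕ → ℝ := fun i => s + (i : ℝ) * Δ with hτ
  set Z : ℝ → ℝ := fun r => ∫ x, ‖curl (u r) x‖ ^ 2 with hZ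
  have hZ0 : ∀ r, 0 ≤ Z r := fun r => integral_nonneg fun x => sq_nonneg _
  have hτN : τ N = t := by rw [hτ]; simp only; rw [hΔ]; field_simp; ring
  have hτ0 : τ 0 = s := by rw [hτ]; simp
  have hτle : ∀ i : ℕ, i ≤ N → τ i ≤ t := fun i hi => by
    have h1 : (i : ℝ) * Δ ≤ (N : ℝ) * Δ := mul_le_mul_of_nonneg_right (by exact_mod_cast hi) hΔ0.le
    have : τ N = t := hτN
    rw [hτ] at this ⊢; simp only at this ⊢; linarith
  have hτge : ∀ i : ℕ, s ≤ τ i := fun i => by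
    have : 0 ≤ (i : ℝ) * Δ := mul_nonneg (Nat.cast_nonneg i) hΔ0.le
    rw [hτ]; simp only; linarith
  -- induction along the partition
  have key : ∀ i : ℕ, i ≤ N → Z (τ i) ≤ Z s * Real.exp (2 * ∑ j ∈ Finset.range i, Ω j * Δ) := by
    intro i
    induction i with
    | zero => intro _; rw [hτ0]; simp
    | succ i ih =>
      intro hi
      have hi' : i < N := Nat.lt_of_succ_le hi
      have hprev := ih hi'.le
      have hs_i : 0 < τ i := hs.trans_le (hτge i)
      have hlt : τ i < τ (i + 1) := by rw [hτ]; simp only; push_cast; nlinarith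
      have hbT : τ (i + 1) < T := (hτle (i + 1) hi).trans_lt htT
      have hmaj : ∀ r ∈ Icc (τ i) (τ (i + 1)), ∀ x, ‖curl (u r) x‖ ≤ Ω i := by
        intro r hr x
        refine hΩ i hi' r ⟨?_, ?_⟩ x
        · have : τ i = s + (i : ℝ) * ((t - s) / N) := rfl
          linarith [hr.1]
        · have : τ (i + 1) = s + ((i : ℝ) + 1) * ((t - s) / N) := by rw [hτ]; simp only; push_cast; ring
          linarith [hr.2]
      have hstep := enstrophy_slab_step hν hT hmax hLH hs_i hlt hbT hmaj
      have hdiff : τ (i + 1) - τ i = Δ := by rw [hτ]; simp only; push_cast; ring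
      have e2 : 2 * Ω i * (τ (i + 1) - τ i) = 2 * (Ω i * Δ) := by rw [hdiff]; ring
      rw [e2] at hstep
      calc Z (τ (i + 1)) ≤ Z (τ i) * Real.exp (2 * (Ω i * Δ)) := hstep
        _ ≤ Z s * Real.exp (2 * ∑ j ∈ Finset.range i, Ω j * Δ) * Real.exp (2 * (Ω i * Δ)) :=
            mul_le_mul_of_nonneg_right hprev (Real.exp_pos _).le
        _ = Z s * Real.exp (2 * ∑ j ∈ Finset.range (i + 1), Ω j * Δ) := by
            rw [Finset.sum_range_succ, mul_add, Real.exp_add, mul_assoc]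
  have h := key N le_rfl
  rw [hτN] at h
  exact h

/-! ## RRS (12.12) with a time-dependent majorant -/

/-- **`∫|ω(t)|² ≤ (∫|ω(s)|²)·exp(2∫_s^t m)` for a continuous majorant `m ≥ ‖ω(τ)‖_∞` on `[s, t] ⊂ (0, T)`** along a
maximal smooth Leray–Hopf solution (Robinson–Rodrigo–Sadowski (12.12) in its printed time-dependent form, on the class).
Proof: for every `η > 0`, by uniform continuity of `m` on `[s, t]` a uniform partition of mesh `< δ` has
`‖ω‖ ≤ m(τ_i) + η` on the `i`-th slab and `∑_i m(τ_i)Δ ≤ ∫m + η(t − s)`, so `enstrophy_chain` gives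
`Z(t) ≤ Z(s)exp(2∫m + 4η(t − s))`; let `η → 0`. [cite: RobinsonRodrigoSadowski2016, Thm 12.3 (12.12)] -/
theorem enstrophy_le_mul_exp_integral {ν T : ℝ} (hν : 0 < ν) (hT : 0 < T)
    {u : ℝ → EuclideanSpace ℝ (Fin 3) → EuclideanSpace ℝ (Fin 3)} {p : ℝ → EuclideanSpace ℝ (Fin 3) → ℝ}
    (hmax : IsMaximalSmoothSolution ν 0 u p T) (hLH : IsLerayHopfOn T ν 0 (u 0) u)
    {s t : ℝ} (hs : 0 < s) (hst : s ≤ t) (htT : t < T)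
    {m : ℝ → ℝ} (hmc : ContinuousOn m (Icc s t)) (hm : ∀ τ ∈ Icc s t, ∀ x, ‖curl (u τ) x‖ ≤ m τ) :
    ∫ x, ‖curl (u t) x‖ ^ 2 ≤ (∫ x, ‖curl (u s) x‖ ^ 2) * Real.exp (2 * ∫ τ in s..t, m τ) := by
  rcases eq_or_lt_of_le hst with heq | hst'
  · subst heq; simp
  set Zs : ℝ := ∫ x, ‖curl (u s) x‖ ^ 2 with hZs
  set Zt : ℝ := ∫ x, ‖curl (u t) x‖ ^ 2 with hZt
  set I : ℝ := ∫ τ in s..t, m τ with hI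
  have hZs0 : 0 ≤ Zs := integral_nonneg fun x => sq_nonneg _
  have hts : 0 < t - s := sub_pos.2 hst'
  -- the bound for every `η > 0`
  have hη : ∀ η : ℝ, 0 < η → Zt ≤ Zs * Real.exp (2 * I + 4 * η * (t - s)) := by
    intro η hη0
    -- uniform continuity of `m` on `[s, t]`
    have huc : UniformContinuousOn m (Icc s t) := isCompact_Icc.uniformContinuousOn_of_continuous hmc
    obtain ⟨δ, hδ0, hδ⟩ := Metric.uniformContinuousOn_iff.1 huc η hη0
    -- a uniform partition of mesh `< δ`
    set N : ℕ := ⌈(t - s) / δ⌉₊ + 1 with hNdef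
    have hN : 0 < N := Nat.succ_pos _
    have hNr : (0 : ℝ) < N := by exact_mod_cast hN
    set Δ : ℝ := (t - s) / N with hΔ
    have hΔ0 : 0 < Δ := div_pos hts hNr
    have hΔδ : Δ < δ := by
      rw [hΔ, div_lt_iff₀ hNr]
      have h1 : (t - s) / δ ≤ ⌈(t - s) / δ⌉₊ := Nat.le_ceil _
      have h2 : (N : ℝ) = ⌈(t - s) / δ⌉₊ + 1 := by rw [hNdef]; push_cast; ring
      rw [div_le_iff₀ hδ0] at h1
      nlinarith [h1, h2, hδ0]
    set τ : ℕ → ℝ := fun i => s + (i : ℝ) * Δ with hτ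
    have hτmem : ∀ i : ℕ, i ≤ N → τ i ∈ Icc s t := fun i hi => by
      refine ⟨by rw [hτ]; simp only; nlinarith [Nat.cast_nonneg (α := ℝ) i], ?_⟩
      have h1 : (i : ℝ) * Δ ≤ (N : ℝ) * Δ := mul_le_mul_of_nonneg_right (by exact_mod_cast hi) hΔ0.le
      have h2 : (N : ℝ) * Δ = t - s := by rw [hΔ]; field_simp
      rw [hτ]; simp only; linarith
    -- on the `i`-th slab, `|m(r) − m(τ_i)| < η`
    have hnear : ∀ i < N, ∀ r ∈ Icc (τ i) (τ (i + 1)), |m r - m (τ i)| < η := by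
      intro i hi r hr
      have hri : τ (i + 1) = τ i + Δ := by rw [hτ]; simp only; push_cast; ring
      have hrmem : r ∈ Icc s t :=
        ⟨(hτmem i hi.le).1.trans hr.1, hr.2.trans (by rw [hri]; linarith [(hτmem (i + 1) hi).2, hri])⟩
      have hdist : dist r (τ i) < δ := by
        rw [Real.dist_eq, abs_of_nonneg (by linarith [hr.1])]
        linarith [hr.2, hri]
      have h := hδ r hrmem (τ i) (hτmem i hi.le) hdist
      rwa [Real.dist_eq] at h
    -- the chain with `Ω_i = m(τ_i) + η`
    have hΩ : ∀ i < N, ∀ r ∈ Icc (s + (i : ℝ) * ((t - s) / N)) (s + ((i : ℝ) + 1) * ((t - s) / N)), ∀ x,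
        ‖curl (u r) x‖ ≤ m (τ i) + η := by
      intro i hi r hr x
      have hr' : r ∈ Icc (τ i) (τ (i + 1)) := by
        refine ⟨?_, ?_⟩
        · have : τ i = s + (i : ℝ) * ((t - s) / N) := rfl
          linarith [hr.1]
        · have : τ (i + 1) = s + ((i : ℝ) + 1) * ((t - s) / N) := by rw [hτ]; simp only; push_cast; ring
          linarith [hr.2]
      have hrmem : r ∈ Icc s t := by
        have hri : τ (i + 1) = τ i + Δ := by rw [hτ]; simp only; push_cast; ring
        exact ⟨(hτmem i hi.le).1.trans hr'.1, hr'.2.trans (by linarith [(hτmem (i + 1) hi).2])⟩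
      have h1 := hm r hrmem x
      have h2 := (abs_lt.1 (hnear i hi r hr')).2
      linarith
    have hchain := enstrophy_chain hν hT hmax hLH hs hst' htT hN (fun i => m (τ i) + η) hΩ
    -- the Riemann sum against the integral
    have hint_i : ∀ i < N, IntervalIntegrable m volume (τ i) (τ (i + 1)) := by
      intro i hi
      have hri : τ i ≤ τ (i + 1) := by rw [hτ]; simp only; push_cast; nlinarith
      refine (hmc.mono ?_).intervalIntegrable_of_Icc hri
      exact Icc_subset_Icc (hτmem i hi.le).1 (hτmem (i + 1) hi).2
    have hsumI : ∑ i ∈ Finset.range N, ∫ r in (τ i)..(τ (i + 1)), m r = I := by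
      rw [hI]
      have h := intervalIntegral.sum_integral_adjacent_intervals (a := τ) (n := N)
        (fun i hi => hint_i i hi)
      have hτ0 : τ 0 = s := by rw [hτ]; simp
      have hτN : τ N = t := by
        rw [hτ]; simp only; rw [hΔ]; field_simp; ring
      rw [hτ0, hτN] at h
      exact h
    have hslab : ∀ i < N, (m (τ i) - η) * Δ ≤ ∫ r in (τ i)..(τ (i + 1)), m r := by
      intro i hi
      have hri : τ (i + 1) = τ i + Δ := by rw [hτ]; simp only; push_cast; ring
      have hle : τ i ≤ τ (i + 1) := by rw [hri]; linarith
      have h1 : ∫ r in (τ i)..(τ (i + 1)), (m (τ i) - η) ≤ ∫ r in (τ i)..(τ (i + 1)), m r := by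
        refine intervalIntegral.integral_mono_on hle intervalIntegrable_const (hint_i i hi) fun r hr => ?_
        have h2 := (abs_lt.1 (hnear i hi r hr)).1
        linarith
      rw [intervalIntegral.integral_const, smul_eq_mul] at h1
      have hd : τ (i + 1) - τ i = Δ := by rw [hri]; ring
      rw [hd] at h1
      have e : Δ * (m (τ i) - η) = (m (τ i) - η) * Δ := by ring
      linarith [h1, e.le, e.ge]
    have hriemann : ∑ i ∈ Finset.range N, (m (τ i) + η) * ((t - s) / N) ≤ I + 2 * η * (t - s) := by
      have h1 : ∑ i ∈ Finset.range N, (m (τ i) + η) * ((t - s) / N) =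
          ∑ i ∈ Finset.range N, (m (τ i) - η) * Δ + ∑ i ∈ Finset.range N, 2 * η * Δ := by
        rw [← Finset.sum_add_distrib]
        refine Finset.sum_congr rfl fun i _ => ?_
        rw [hΔ]; ring
      have h2 : ∑ i ∈ Finset.range N, (m (τ i) - η) * Δ ≤ I := by
        rw [← hsumI]
        exact Finset.sum_le_sum fun i hi => hslab i (Finset.mem_range.1 hi)
      have h3 : ∑ i ∈ Finset.range N, 2 * η * Δ = 2 * η * (t - s) := by
        rw [Finset.sum_const, Finset.card_range, nsmul_eq_mul, hΔ]
        field_simp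
      linarith [h1, h2, h3]
    calc Zt ≤ Zs * Real.exp (2 * ∑ i ∈ Finset.range N, (m (τ i) + η) * ((t - s) / N)) := hchain
      _ ≤ Zs * Real.exp (2 * I + 4 * η * (t - s)) := by
          refine mul_le_mul_of_nonneg_left (Real.exp_le_exp.2 ?_) hZs0
          linarith [hriemann]
  -- `η → 0`
  set R : ℝ := Zs * Real.exp (2 * I) with hR
  have hR0 : 0 ≤ R := mul_nonneg hZs0 (Real.exp_pos _).le
  refine le_of_forall_pos_le_add fun ε hε => ?_
  have hcont : Tendsto (fun η : ℝ => R * Real.exp (4 * η * (t - s))) (𝓝 0) (𝓝 R) := by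
    have h : Continuous fun η : ℝ => R * Real.exp (4 * η * (t - s)) := by fun_prop
    have h0 : R * Real.exp (4 * (0 : ℝ) * (t - s)) = R := by simp
    simpa [h0] using h.tendsto 0
  have hev : ∀ᶠ η : ℝ in 𝓝 0, R * Real.exp (4 * η * (t - s)) < R + ε :=
    hcont.eventually (gt_mem_nhds (lt_add_of_pos_right R hε))
  obtain ⟨δ', hδ'0, hball⟩ := Metric.eventually_nhds_iff.1 hev
  have hη2 : dist (δ' / 2) (0 : ℝ) < δ' := by
    rw [Real.dist_eq, sub_zero, abs_of_pos (by positivity)]; linarith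
  have h1 := hη (δ' / 2) (by positivity)
  have h2 := hball hη2
  have e : Zs * Real.exp (2 * I + 4 * (δ' / 2) * (t - s)) = R * Real.exp (4 * (δ' / 2) * (t - s)) := by
    rw [hR, Real.exp_add]; ring
  rw [e] at h1
  exact h1.trans h2.le

/-! ## L65-S: BKM with the logarithmic floor `1/4` -/

/-- **L65-S — BKM WITH AN EXPLICIT LOGARITHMIC FLOOR.** With the absolute constant `c` of Leray's vorticity clock
(`VorticityTypeIFace.leray_curl_clock`): for every `ν > 0`, `T > 0`, every maximal smooth solution `(u, p)` of the
unforced Navier–Stokes system on `ℝ³ × [0, T)` which is Leray–Hopf from `u 0`, every `t₀ ∈ (0, T)`, every continuous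
`m` on `[t₀, T)` with `‖curl u(τ, x)‖ ≤ m(τ)` there, and every `t ∈ [t₀, T)`:
`c ν³ ≤ (∫|curl u(t₀)|²)² · exp(4∫_{t₀}^t m) · (T − t)` (`enstrophy_le_mul_exp_integral` squared against Leray's
rate at `t`). [cite: RobinsonRodrigoSadowski2016, Thm 12.3 (12.12) and Lemma 6.11] [cite: Leray1934, §20] -/
theorem bkm_log_floor :
    ∃ c : ℝ, 0 < c ∧ ∀ (ν T : ℝ), 0 < ν → 0 < T →
      ∀ (u : ℝ → EuclideanSpace ℝ (Fin 3) → EuclideanSpace ℝ (Fin 3)) (p : ℝ → EuclideanSpace ℝ (Fin 3) → ℝ),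
      IsMaximalSmoothSolution ν 0 u p T → IsLerayHopfOn T ν 0 (u 0) u →
      ∀ t₀ ∈ Ioo 0 T, ∀ m : ℝ → ℝ, ContinuousOn m (Ico t₀ T) →
        (∀ τ ∈ Ico t₀ T, ∀ x, ‖curl (u τ) x‖ ≤ m τ) →
        ∀ t ∈ Ico t₀ T, c * ν ^ 3 ≤
          (∫ x, ‖curl (u t₀) x‖ ^ 2) ^ 2 * Real.exp (4 * ∫ τ in t₀..t, m τ) * (T - t) := by
  obtain ⟨c, hc, H⟩ := leray_curl_clock
  refine ⟨c, hc, fun ν T hν hT u p hmax hLH t₀ ht₀ m hmc hm t ht => ?_⟩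
  have htI : t ∈ Ioo 0 T := ⟨ht₀.1.trans_le ht.1, ht.2⟩
  have hsub : Icc t₀ t ⊆ Ico t₀ T := fun τ hτ => ⟨hτ.1, hτ.2.trans_lt ht.2⟩
  have h1 := H ν T hν hT u p hmax hLH t htI
  have h2 := enstrophy_le_mul_exp_integral hν hT hmax hLH ht₀.1 ht.1 ht.2 (hmc.mono hsub)
    fun τ hτ x => hm τ (hsub hτ) x
  have hZ0 : 0 ≤ ∫ x, ‖curl (u t) x‖ ^ 2 := integral_nonneg fun x => sq_nonneg _
  have h3 : (∫ x, ‖curl (u t) x‖ ^ 2) ^ 2 ≤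
      ((∫ x, ‖curl (u t₀) x‖ ^ 2) * Real.exp (2 * ∫ τ in t₀..t, m τ)) ^ 2 := pow_le_pow_left₀ hZ0 h2 2
  have e : ((∫ x, ‖curl (u t₀) x‖ ^ 2) * Real.exp (2 * ∫ τ in t₀..t, m τ)) ^ 2 =
      (∫ x, ‖curl (u t₀) x‖ ^ 2) ^ 2 * Real.exp (4 * ∫ τ in t₀..t, m τ) := by
    rw [mul_pow, ← Real.exp_nat_mul]; push_cast; ring_nf
  rw [e] at h3
  exact h1.trans (mul_le_mul_of_nonneg_right h3 (sub_pos.2 ht.2).le)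

/-- **L65-S IN LOGARITHMS: `log( cν³ / (Z(t₀)²(T − t)) ) ≤ 4∫_{t₀}^t m`** — the running BKM integral of any continuous
majorant `m` of `‖ω(τ)‖_∞` on `[t₀, T)` grows at least like `(1/4)·log(1/(T − t))` (up to the additive constant
`¼ log(cν³/Z(t₀)²)`, `Z(t₀) = ∫|ω(t₀)|²`), with the constant `c` of `bkm_log_floor`; in particular it diverges (L31) and
`(T − t)‖ω(t)‖_∞ ≥ 1/4 − o(1)` along a sequence (L65). [cite: RobinsonRodrigoSadowski2016, Thm 12.3 (12.12) and Lemma 6.11] -/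
theorem bkm_log_floor_log {ν T : ℝ} (hν : 0 < ν) (hT : 0 < T)
    {u : ℝ → EuclideanSpace ℝ (Fin 3) → EuclideanSpace ℝ (Fin 3)} {p : ℝ → EuclideanSpace ℝ (Fin 3) → ℝ}
    (hmax : IsMaximalSmoothSolution ν 0 u p T) (hLH : IsLerayHopfOn T ν 0 (u 0) u)
    {t₀ : ℝ} (ht₀ : t₀ ∈ Ioo 0 T) {m : ℝ → ℝ} (hmc : ContinuousOn m (Ico t₀ T))
    (hm : ∀ τ ∈ Ico t₀ T, ∀ x, ‖curl (u τ) x‖ ≤ m τ) {t : ℝ} (ht : t ∈ Ico t₀ T) :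
    Real.log (bkm_log_floor.choose * ν ^ 3 / ((∫ x, ‖curl (u t₀) x‖ ^ 2) ^ 2 * (T - t))) ≤
      4 * ∫ τ in t₀..t, m τ := by
  have hc := bkm_log_floor.choose_spec.1
  have h := bkm_log_floor.choose_spec.2 ν T hν hT u p hmax hLH t₀ ht₀ m hmc hm t ht
  set c : ℝ := bkm_log_floor.choose with hcdef
  set Z₀ : ℝ := ∫ x, ‖curl (u t₀) x‖ ^ 2 with hZ₀
  set I : ℝ := ∫ τ in t₀..t, m τ with hI
  have hTt : 0 < T - t := sub_pos.2 ht.2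
  have hcν : 0 < c * ν ^ 3 := mul_pos hc (pow_pos hν 3)
  -- `Z₀ > 0` (else Leray's rate fails)
  have hZpos : 0 < Z₀ ^ 2 * (T - t) := by
    by_contra h0
    have h0' : Z₀ ^ 2 * (T - t) ≤ 0 := not_lt.1 h0
    have : c * ν ^ 3 ≤ 0 := by
      calc c * ν ^ 3 ≤ Z₀ ^ 2 * Real.exp (4 * I) * (T - t) := h
        _ = Z₀ ^ 2 * (T - t) * Real.exp (4 * I) := by ring
        _ ≤ 0 := mul_nonpos_of_nonpos_of_nonneg h0' (Real.exp_pos _).le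
    linarith
  rw [Real.log_le_iff_le_exp (div_pos hcν hZpos), div_le_iff₀ hZpos]
  calc c * ν ^ 3 ≤ Z₀ ^ 2 * Real.exp (4 * I) * (T - t) := h
    _ = Real.exp (4 * I) * (Z₀ ^ 2 * (T - t)) := by ring

end Summit.NavierStokesRegularity.FluidComputer.VorticityLogFloor

end
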